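import Literature.Probability.RandomPlanarGeometry.HexParafermionProofs
import Literature.Probability.RandomPlanarGeometry.HexSAW
import HarnessLib

/-!
# Cutting a self-avoiding walk of `Ω_δ ⊆ δℍ` into an outer pair of pieces and a mid-edge arc

The two-sided DOMAIN MARKOV decomposition of the critical hexagonal-lattice SAW measure
`P ∝ x_c^{#vertices}` (Duminil-Copin–Smirnov, Ann. of Math. 175 (2012) §2: walks between
mid-edges; Madras–Slade, *The self-avoiding walk* (1993) §1.2: concatenation), as exact
combinatorics on vertex lists, with NO new definitions:

* `exists_hexMidEdgeSAW_of_support_eq` — if the support of a SAW `ω` of `Ω_δ`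
  (`HexDomainSAW Ω δ a b`) is `β₀ ++ p₀ :: (c ++ p₀' :: β₀')` with `c ≠ []`, then `c` is the vertex
  list of a self-avoiding arc (`HexMidEdgeSAW`) of the vertex set `Λ₀ ∖ (β₀ ++ [p₀]) ∖ (p₀' :: β₀')`
  from the mid-edge `{p₀, head c}` to the mid-edge `{last c, p₀'}`, using only edges of `Ω_δ`;
* `exists_hexDomainSAW_of_hexMidEdgeSAW` — conversely every such arc using only edges of `Ω_δ`
  glues with the outer pieces of a witness SAW to a SAW of `Ω_δ` with support
  `β₀ ++ p₀ :: (verts ++ p₀' :: β₀')`;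
* small dictionary lemmas: `vertexCount_eq_length_support`, reversal of SAWs
  (`exists_reverse_hexDomainSAW`, `sum_support_eq_sum_reverse`); the consecutive-pair edges of a
  list are handled by `forall_mem_of_mem_edges` / `edges_nodup` of `HexParafermionProofs.lean`.

Deliberately NOT here: the resulting bijection as an identity of sums (`sum_fibre_eq_sum_arcs` in
`HexSAWArcFibreBound.lean`); the choice of the cut (first entrance / last exit of a ball), which is
made by the user; measures; anything metric.
-/

noncomputable section

open scoped Classical
open Literature.Probability.LatticeModels

namespace Literature.Probability.RandomPlanarGeometry.SAW

/-! ### Heads and last elements of glued lists -/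

section Lists

variable {V : Type*}

/-- The head of `l ++ p :: X` does not depend on `X`. [folklore] -/
theorem head_append_cons_eq (l : List V) (p : V) (X Y : List V) (h1 : l ++ p :: X ≠ [])
    (h2 : l ++ p :: Y ≠ []) : (l ++ p :: X).head h1 = (l ++ p :: Y).head h2 := by
  cases l <;> simp

/-- The last element of `X ++ p :: l` does not depend on `X`. [folklore] -/
theorem getLast_append_cons_eq (l : List V) (p : V) (X Y : List V) (h1 : X ++ p :: l ≠ [])
    (h2 : Y ++ p :: l ≠ []) : (X ++ p :: l).getLast h1 = (Y ++ p :: l).getLast h2 := by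
  rw [List.getLast_append_of_ne_nil _ (List.cons_ne_nil p l),
    List.getLast_append_of_ne_nil _ (List.cons_ne_nil p l)]

end Lists

/-! ### Supports of SAWs of `Ω_δ` -/

section Support

variable {Ω : Set ℂ} {δ : ℝ} {a b : HexVertex}

/-- `ℓ(γ)` (number of vertices) is the length of the support. [folklore] -/
theorem vertexCount_eq_length_support (ω : HexDomainSAW Ω δ a b) :
    ω.vertexCount = ω.walk.support.length := by
  rw [EmbDomainSAW.vertexCount, EmbDomainSAW.length, SimpleGraph.Walk.length_support]

/-- Two SAWs with the same support are equal. [folklore] -/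
theorem hexDomainSAW_eq_of_support_eq {ω ω' : HexDomainSAW Ω δ a b}
    (h : ω.walk.support = ω'.walk.support) : ω = ω' := by
  have hw : ω.walk = ω'.walk := SimpleGraph.Walk.ext_support h
  cases ω; cases ω'
  cases hw
  rfl

/-- A SAW of `Ω_δ` with prescribed support exists as soon as the list is a duplicate-free chain of
`Ω_δ` from `a` to `b`. [folklore] -/
theorem exists_hexDomainSAW_of_isChain {L : List HexVertex} (hne : L ≠ [])
    (hchain : L.IsChain (hexDomainGraph Ω δ).Adj) (hnd : L.Nodup) (ha : L.head hne = a)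
    (hb : L.getLast hne = b) : ∃ ω : HexDomainSAW Ω δ a b, ω.walk.support = L := by
  refine ⟨⟨(SimpleGraph.Walk.ofSupport L hne hchain).copy ha hb, SimpleGraph.Walk.IsPath.mk' ?_⟩,
    ?_⟩
  · rw [SimpleGraph.Walk.support_copy, SimpleGraph.Walk.support_ofSupport]; exact hnd
  · change ((SimpleGraph.Walk.ofSupport L hne hchain).copy ha hb).support = L
    rw [SimpleGraph.Walk.support_copy, SimpleGraph.Walk.support_ofSupport]

/-- **Reversal of SAWs.** The reversed walk is a SAW from `b` to `a` with reversed support (same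
number of vertices). [folklore] -/
theorem exists_reverse_hexDomainSAW (ω : HexDomainSAW Ω δ a b) :
    ∃ ω' : HexDomainSAW Ω δ b a, ω'.walk.support = ω.walk.support.reverse :=
  ⟨⟨ω.walk.reverse, ω.isPath.reverse⟩, SimpleGraph.Walk.support_reverse _⟩

/-- **Reversal symmetry of sums over SAWs**: summing a function of the support over the SAWs
`a → b` is summing it, composed with list reversal, over the SAWs `b → a`. [folklore] -/
theorem sum_support_eq_sum_reverse [Fintype (HexDomainSAW Ω δ a b)] [Fintype (HexDomainSAW Ω δ b a)]
    (w : List HexVertex → ℝ) :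
    ∑ ω : HexDomainSAW Ω δ a b, w ω.walk.support =
      ∑ ω : HexDomainSAW Ω δ b a, w ω.walk.support.reverse := by
  refine Fintype.sum_equiv ⟨fun ω => ⟨ω.walk.reverse, ω.isPath.reverse⟩,
    fun ω => ⟨ω.walk.reverse, ω.isPath.reverse⟩, fun ω => ?_, fun ω => ?_⟩ _ _ fun ω => ?_
  · cases ω; simp only [SimpleGraph.Walk.reverse_reverse]
  · cases ω; simp only [SimpleGraph.Walk.reverse_reverse]
  · simp only [Equiv.coe_fn_mk, SimpleGraph.Walk.support_reverse, List.reverse_reverse]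

end Support

/-! ### From a SAW to a mid-edge arc -/

section Cut

variable {Ω : Set ℂ} {δ : ℝ} {a b : HexVertex}

/-- **Cutting.** If the support of the SAW `ω` of `Ω_δ` reads `β₀ ++ p₀ :: (c ++ p₀' :: β₀')` with
`c ≠ []`, then `c` is the vertex list of a self-avoiding mid-edge arc of the vertex set
`Λ₀ ∖ (β₀ ++ [p₀]) ∖ (p₀' :: β₀')` (`Λ₀` any vertex set containing the support) from `{p₀, head c}`
to `{last c, p₀'}`, and the arc uses only edges of `Ω_δ`. (Two-sided domain Markov property,
combinatorial half.) [cite: DuminilCopinSmirnov2012, §2 (walks between mid-edges)] -/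
theorem exists_hexMidEdgeSAW_of_support_eq (ω : HexDomainSAW Ω δ a b) (Λ₀ : Finset HexVertex)
    (hΛ₀ : ∀ v ∈ ω.walk.support, v ∈ Λ₀) {β₀ c β₀' : List HexVertex} {p₀ p₀' : HexVertex}
    (hc : c ≠ []) (hL : ω.walk.support = β₀ ++ p₀ :: (c ++ p₀' :: β₀')) :
    ∃ α : HexMidEdgeSAW ((Λ₀ \ (β₀ ++ [p₀]).toFinset) \ (p₀' :: β₀').toFinset)
      s(p₀, c.head hc) s(c.getLast hc, p₀'), α.verts = c ∧ α.verts.IsChain (hexDomainGraph Ω δ).Adj := by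
  set H := hexDomainGraph Ω δ with hH
  have hnd : (β₀ ++ p₀ :: (c ++ p₀' :: β₀')).Nodup := hL ▸ ω.isPath.support_nodup
  have hchain : (β₀ ++ p₀ :: (c ++ p₀' :: β₀')).IsChain H.Adj := hL ▸ ω.walk.isChain_adj_support
  -- reshufflings of the support
  have e1 : β₀ ++ p₀ :: (c ++ p₀' :: β₀') = (β₀ ++ [p₀]) ++ (c ++ p₀' :: β₀') := by simp
  have e2 : β₀ ++ p₀ :: (c ++ p₀' :: β₀') = (β₀ ++ p₀ :: c) ++ (p₀' :: β₀') := by simp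
  -- membership facts from self-avoidance
  have hcnd : c.Nodup := by
    rw [e1] at hnd
    exact (hnd.of_append_right).of_append_left
  have hc_pre : ∀ v ∈ c, v ∉ β₀ ++ [p₀] := by
    intro v hv hv'
    rw [e1] at hnd
    exact List.disjoint_of_nodup_append hnd hv' (List.mem_append_left _ hv)
  have hc_suf : ∀ v ∈ c, v ∉ p₀' :: β₀' := by
    intro v hv hv'
    rw [e1] at hnd
    have h2 := hnd.of_append_right
    exact List.disjoint_of_nodup_append h2 hv hv'
  have hp₀c : p₀ ∉ c := fun h => hc_pre p₀ h (by simp)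
  have hp₀'c : p₀' ∉ c := fun h => hc_suf p₀' h (by simp)
  have hp₀p₀' : p₀ ≠ p₀' := by
    intro h
    rw [e1] at hnd
    exact List.disjoint_of_nodup_append hnd (by simp : p₀ ∈ β₀ ++ [p₀])
      (by simp [h] : p₀ ∈ c ++ p₀' :: β₀')
  -- the chain restricted to `c` and the two junction edges
  have hcchain : c.IsChain H.Adj := by
    rw [e1] at hchain
    exact hchain.right_of_append.left_of_append
  have hadj₁ : H.Adj p₀ (c.head hc) := by
    rw [e1] at hchain
    have := hchain.rel_getLast_head_of_append (by simp) (by simp [hc])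
    simpa [List.head_append_of_ne_nil hc] using this
  have hadj₂ : H.Adj (c.getLast hc) p₀' := by
    rw [e2] at hchain
    have := hchain.rel_getLast_head_of_append (by simp) (by simp)
    simpa [List.getLast_append_of_ne_nil _ (List.cons_ne_nil p₀ c), List.getLast_cons hc]
      using this
  have hsub : ∀ v ∈ c, v ∈ (Λ₀ \ (β₀ ++ [p₀]).toFinset) \ (p₀' :: β₀').toFinset := by
    intro v hv
    simp only [Finset.mem_sdiff, List.mem_toFinset]
    exact ⟨⟨hΛ₀ v (by rw [hL]; simp [hv]), hc_pre v hv⟩, hc_suf v hv⟩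
  refine ⟨{ verts := c
            subset := hsub
            nodup := hcnd
            isChain := hcchain.imp fun u w h => embDomainGraph_le _ _ _ _ h
            head_mem := ?_
            getLast_mem := ?_
            eq_of_nil := fun h => absurd h hc
            edges_nodup := fun _ => ?_
            fst_mem := ?_ }, rfl, hcchain⟩
  · intro v hv
    rw [List.head?_eq_some_head hc, Option.some.injEq] at hv
    rw [← hv]; exact Sym2.mem_mk_right _ _
  · intro v hv
    rw [List.getLast?_eq_some_getLast hc, Option.some.injEq] at hv
    rw [← hv]; exact Sym2.mem_mk_left _ _
  · -- no edge twice: the two door edges contain `p₀ ∉ c`, `p₀' ∉ c`, the inner ones are inside `c`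
    set ez := List.zipWith (fun u w => s(u, w)) c c.tail with hez
    have hm : s(p₀, c.head hc) ∉ ez := fun h =>
      hp₀c (forall_mem_of_mem_edges _ _ h p₀ (Sym2.mem_mk_left _ _))
    have hm' : s(c.getLast hc, p₀') ∉ ez := fun h =>
      hp₀'c (forall_mem_of_mem_edges _ _ h p₀' (Sym2.mem_mk_right _ _))
    have hmm' : s(p₀, c.head hc) ≠ s(c.getLast hc, p₀') := fun h => by
      rcases Sym2.eq_iff.1 h with ⟨h1, -⟩ | ⟨h1, -⟩
      · exact hp₀c (h1 ▸ List.getLast_mem hc)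
      · exact hp₀p₀' h1
    refine List.nodup_append.2 ⟨List.nodup_cons.2 ⟨hm, edges_nodup hcnd⟩,
      List.nodup_singleton _, fun e he e' he' => ?_⟩
    rw [List.mem_singleton] at he'
    subst he'
    rcases List.mem_cons.1 he with rfl | he
    · exact hmm'
    · exact fun h => hm' (h ▸ he)
  · refine ⟨(embDomainGraph_le _ _ _ _ hadj₁ : hexGraph.Adj _ _), c.head hc, Sym2.mem_mk_right _ _,
      hsub _ (List.head_mem hc)⟩

end Cut

/-! ### From a mid-edge arc back to a SAW (gluing) -/

section Glue

variable {Ω : Set ℂ} {δ : ℝ} {a b : HexVertex}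

/-- **Gluing.** Let the SAW `ω₀` of `Ω_δ` have support `β₀ ++ p₀ :: (c₀ ++ p₀' :: β₀')` with
`c₀ ≠ []`, `head c₀ = c₁`, `last c₀ = c_L`. Then every self-avoiding mid-edge arc `α` of the vertex
set `Λ₀ ∖ (β₀ ++ [p₀]) ∖ (p₀' :: β₀')` from `{p₀, c₁}` to `{c_L, p₀'}` using only edges of `Ω_δ`
glues with the outer pieces of `ω₀` to a SAW of `Ω_δ` from `a` to `b` with support
`β₀ ++ p₀ :: (verts α ++ p₀' :: β₀')`; its vertex list is nonempty, starts at `c₁` and ends at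
`c_L`. (Two-sided domain Markov property, combinatorial half; concatenation of SAWs.)
[cite: DuminilCopinSmirnov2012, §2 (walks between mid-edges)] -/
theorem exists_hexDomainSAW_of_hexMidEdgeSAW (ω₀ : HexDomainSAW Ω δ a b)
    {β₀ c₀ β₀' : List HexVertex} {p₀ p₀' c₁ c_L : HexVertex} (hc₀ : c₀ ≠ [])
    (h₀ : ω₀.walk.support = β₀ ++ p₀ :: (c₀ ++ p₀' :: β₀')) (hc₁ : c₀.head hc₀ = c₁)
    (hcL : c₀.getLast hc₀ = c_L) {Λ₀ : Finset HexVertex}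
    (α : HexMidEdgeSAW ((Λ₀ \ (β₀ ++ [p₀]).toFinset) \ (p₀' :: β₀').toFinset) s(p₀, c₁) s(c_L, p₀'))
    (hα : α.verts.IsChain (hexDomainGraph Ω δ).Adj) :
    ∃ ω : HexDomainSAW Ω δ a b, ∃ hne : α.verts ≠ [],
      ω.walk.support = β₀ ++ p₀ :: (α.verts ++ p₀' :: β₀') ∧ α.verts.head hne = c₁ ∧
        α.verts.getLast hne = c_L := by
  set H := hexDomainGraph Ω δ with hH
  have hnd : (β₀ ++ p₀ :: (c₀ ++ p₀' :: β₀')).Nodup := h₀ ▸ ω₀.isPath.support_nodup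
  have hchain : (β₀ ++ p₀ :: (c₀ ++ p₀' :: β₀')).IsChain H.Adj := h₀ ▸ ω₀.walk.isChain_adj_support
  have e1 : ∀ c : List HexVertex,
      β₀ ++ p₀ :: (c ++ p₀' :: β₀') = (β₀ ++ [p₀]) ++ (c ++ p₀' :: β₀') := fun c => by simp
  have e2 : ∀ c : List HexVertex,
      β₀ ++ p₀ :: (c ++ p₀' :: β₀') = (β₀ ++ p₀ :: c) ++ (p₀' :: β₀') := fun c => by simp
  have e3 : ∀ c : List HexVertex,
      β₀ ++ p₀ :: (c ++ p₀' :: β₀') = (β₀ ++ [p₀]) ++ c ++ (p₀' :: β₀') := fun c => by simp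
  -- facts about the witness
  have hc₁_mem : c₁ ∈ c₀ := hc₁ ▸ List.head_mem hc₀
  have hcL_mem : c_L ∈ c₀ := hcL ▸ List.getLast_mem hc₀
  have hpre_nd : (β₀ ++ [p₀]).Nodup := by rw [e1] at hnd; exact hnd.of_append_left
  have hsuf_nd : (p₀' :: β₀').Nodup := by rw [e1] at hnd; exact hnd.of_append_right.of_append_right
  have hpre_suf : ∀ v ∈ β₀ ++ [p₀], v ∉ p₀' :: β₀' := by
    intro v hv hv'
    rw [e1] at hnd
    exact List.disjoint_of_nodup_append hnd hv (List.mem_append_right _ hv')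
  have hc₀_pre : ∀ v ∈ c₀, v ∉ β₀ ++ [p₀] := by
    intro v hv hv'
    rw [e1] at hnd
    exact List.disjoint_of_nodup_append hnd hv' (List.mem_append_left _ hv)
  have hp₀p₀' : p₀ ≠ p₀' := fun h => hpre_suf p₀ (by simp) (by simp [h])
  have hp₀cL : p₀ ≠ c_L := fun h => hc₀_pre c_L hcL_mem (by simp [h])
  have hpre_chain : (β₀ ++ [p₀]).IsChain H.Adj := by rw [e1] at hchain; exact hchain.left_of_append
  have hsuf_chain : (p₀' :: β₀').IsChain H.Adj := by
    rw [e1] at hchain; exact hchain.right_of_append.right_of_append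
  have hadj₁ : H.Adj p₀ c₁ := by
    rw [e1] at hchain
    have := hchain.rel_getLast_head_of_append (by simp) (by simp [hc₀])
    simpa [List.head_append_of_ne_nil hc₀, hc₁] using this
  have hadj₂ : H.Adj c_L p₀' := by
    rw [e2] at hchain
    have := hchain.rel_getLast_head_of_append (by simp) (by simp)
    simpa [List.getLast_append_of_ne_nil _ (List.cons_ne_nil p₀ c₀), List.getLast_cons hc₀, hcL]
      using this
  have ha : (β₀ ++ p₀ :: (c₀ ++ p₀' :: β₀')).head (by simp) = a := by
    have h := ω₀.walk.head_support
    simp only [h₀] at h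
    exact h
  have hb : (β₀ ++ p₀ :: (c₀ ++ p₀' :: β₀')).getLast (by simp) = b := by
    have h := ω₀.walk.getLast_support
    simp only [h₀] at h
    exact h
  -- facts about the arc
  have hαΛ : ∀ v ∈ α.verts, v ∉ β₀ ++ [p₀] ∧ v ∉ p₀' :: β₀' := by
    intro v hv
    have := α.subset v hv
    simp only [Finset.mem_sdiff, List.mem_toFinset] at this
    exact ⟨this.1.2, this.2⟩
  have hne : α.verts ≠ [] := by
    intro h
    have := α.eq_of_nil h
    rcases Sym2.eq_iff.1 this with ⟨h1, -⟩ | ⟨h1, -⟩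
    · exact hp₀cL h1
    · exact hp₀p₀' h1
  have hhead : α.verts.head hne = c₁ := by
    have h1 := α.head_mem _ (List.head?_eq_some_head hne)
    rcases Sym2.mem_iff.1 h1 with h | h
    · have := (hαΛ _ (List.head_mem hne)).1
      rw [h] at this
      exact absurd (by simp : p₀ ∈ β₀ ++ [p₀]) this
    · exact h
  have hlast : α.verts.getLast hne = c_L := by
    have h1 := α.getLast_mem _ (List.getLast?_eq_some_getLast hne)
    rcases Sym2.mem_iff.1 h1 with h | h
    · exact h
    · have := (hαΛ _ (List.getLast_mem hne)).2
      rw [h] at this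
      exact absurd (by simp : p₀' ∈ p₀' :: β₀') this
  -- the glued list
  set L := β₀ ++ p₀ :: (α.verts ++ p₀' :: β₀') with hLdef
  have hLne : L ≠ [] := by simp [hLdef]
  have hLchain : L.IsChain H.Adj := by
    rw [hLdef, e3]
    refine List.IsChain.append (List.IsChain.append hpre_chain hα ?_) hsuf_chain ?_
    · intro x hx y hy
      rw [List.getLast?_eq_some_getLast (by simp), Option.mem_def, Option.some.injEq] at hx
      rw [List.head?_eq_some_head hne, Option.mem_def, Option.some.injEq] at hy
      subst hx; subst hy
      simpa [hhead] using hadj₁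
    · intro x hx y hy
      rw [List.getLast?_eq_some_getLast (by simp), Option.mem_def, Option.some.injEq] at hx
      rw [List.head?_cons, Option.mem_def, Option.some.injEq] at hy
      subst hx; subst hy
      rw [List.getLast_append_of_ne_nil _ hne, hlast]
      exact hadj₂
  have hLnd : L.Nodup := by
    rw [hLdef, e3]
    refine List.Nodup.append (List.Nodup.append hpre_nd α.nodup ?_) hsuf_nd ?_
    · exact fun v hv hv' => (hαΛ v hv').1 hv
    · intro v hv hv'
      rcases List.mem_append.1 hv with hv | hv
      · exact hpre_suf v hv hv'
      · exact (hαΛ v hv).2 hv'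
  have hLa : L.head hLne = a := by
    rw [← ha]
    exact head_append_cons_eq β₀ p₀ _ _ _ _
  have hLb : L.getLast hLne = b := by
    rw [← hb]
    have e4 : ∀ c : List HexVertex,
        β₀ ++ p₀ :: (c ++ p₀' :: β₀') = (β₀ ++ p₀ :: c) ++ p₀' :: β₀' := fun c => by simp
    simp only [hLdef, e4]
    exact getLast_append_cons_eq β₀' p₀' _ _ _ _
  obtain ⟨ω, hω⟩ := exists_hexDomainSAW_of_isChain hLne hLchain hLnd hLa hLb
  exact ⟨ω, hne, hω, hhead, hlast⟩

end Glue

end Literature.Probability.RandomPlanarGeometry.SAW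

end
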